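import Literature.Geometry.Symplectic.GromovMcDuffChartFormRelEnd
import Literature.Geometry.Symplectic.StandardEnd
import Literature.Topology.FourManifolds.HomotopySpheres
import Literature.Geometry.Manifold.InjOnLocalDiffeomorphInverse
import Mathlib.Topology.Maps.Proper.CompactlyGenerated
import Mathlib.Analysis.Complex.Basic

/-!
# Helper `helper_diffeoOfProperInjective` of line `Sketch` for crux `WitnessCharge`
(item stmt-SmoothPoincare4-7824; route `SullivanDual`, crux
`Summit.SmoothPoincare4.SmoothPoincare4.Theses.SullivanDual.WitnessCharge`; line `Sketch`,
registered stub `helper_diffeoOfProperInjective` of the lead's complete-family mini-skeleton,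
wave 4 — classical glue: diffeomorphism packaging)

**A proper injective immersion `ℂ × ℂ → Σ∖p` is a diffeomorphism.** Let `Σ` be a homotopy
`4`-sphere, `p ∈ Σ`, and `Φ : ℂ × ℂ → Σ∖p` (`punctured p`, an open submanifold of `Σ`) a `C^∞`
map which is injective, has injective differential everywhere, and is proper (preimages of compact
sets are compact). Then `Φ` is (the underlying map of) a diffeomorphism `ℂ × ℂ ≃ₘ Σ∖p`.

Proof (classical: a proper injective local diffeomorphism onto a connected manifold is a
diffeomorphism).
* The differential `mfderiv Φ q : ℂ × ℂ →L[ℝ] ℝ⁴` is injective between real vector spaces of the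
  same dimension `4`, hence bijective (`helper_diffeoOfProperInjective_bijective_mfderiv`); by the
  inverse function theorem for manifolds
  (`Literature.Geometry.Manifold.isLocalDiffeomorphAt_of_bijective_mfderiv`, Lee 2013, Thm. 4.5)
  `Φ` is a local diffeomorphism (`helper_diffeoOfProperInjective_isLocalDiffeomorph`).
* `range Φ` is open (local diffeomorphisms are open maps), closed (a proper map into the locally
  compact Hausdorff space `Σ∖p` is closed: `isProperMap_iff_isCompact_preimage`,
  `IsProperMap.isClosedMap`) and nonempty, and `Σ∖p` is connected
  (`Literature.Geometry.Symplectic.pathConnectedSpace_punctured_of_homotopySphere`), so `Φ` is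
  surjective (`helper_diffeoOfProperInjective_surjective`).
* A bijective local diffeomorphism is a diffeomorphism
  (`IsLocalDiffeomorph.diffeomorphOfBijective`).

Everything here is proved; no facts and no definitions are introduced.
-/

noncomputable section

-- the prescribed namespace `Summit.<P>.<Sub>.…` duplicates `SmoothPoincare4` (P = Sub)
set_option linter.dupNamespace false

open scoped Manifold ContDiff Topology
open Set Filter Literature.Geometry.Kaehler Literature.Geometry.Symplectic
  Literature.Topology.FourManifolds

namespace Summit.SmoothPoincare4.SmoothPoincare4.Theorems.WitnessCharge.PencilIncompleteness

/-- **Dimension count.** An injective differential `ℂ × ℂ →L[ℝ] T(Σ∖p) = ℝ⁴` of a map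
`Φ : ℂ × ℂ → Σ∖p` is bijective: both sides are real vector spaces of dimension `4`
(`Complex.finrank_real_complex`, `Module.finrank_prod`, `finrank_euclideanSpace_fin`), and an
injective linear map between finite-dimensional spaces of equal dimension is surjective
(`LinearMap.injective_iff_surjective_of_finrank_eq_finrank`). -/
theorem helper_diffeoOfProperInjective_bijective_mfderiv {S : HomotopySphere 4} {p : S.carrier}
    (Φ : ℂ × ℂ → punctured p) (q : ℂ × ℂ)
    (hq : Function.Injective (mfderiv 𝓘(ℝ, ℂ × ℂ) (𝓡 4) Φ q)) :
    Function.Bijective (mfderiv 𝓘(ℝ, ℂ × ℂ) (𝓡 4) Φ q) := by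
  obtain ⟨L, hL⟩ : ∃ L : (ℂ × ℂ) →L[ℝ] EuclideanSpace ℝ (Fin 4),
      L = mfderiv 𝓘(ℝ, ℂ × ℂ) (𝓡 4) Φ q := ⟨_, rfl⟩
  have hdim : Module.finrank ℝ (ℂ × ℂ) = Module.finrank ℝ (EuclideanSpace ℝ (Fin 4)) := by
    simp [Module.finrank_prod, Complex.finrank_real_complex]
  have hLinj : Function.Injective L := by
    rw [hL]
    exact hq
  have hLsurj : Function.Surjective L :=
    (LinearMap.injective_iff_surjective_of_finrank_eq_finrank (f := (L : (ℂ × ℂ) →ₗ[ℝ] _)) hdim).1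
      hLinj
  refine ⟨hq, ?_⟩
  rw [← hL]
  exact hLsurj

/-- **Inverse function theorem step.** A `C^∞` map `Φ : ℂ × ℂ → Σ∖p` with everywhere injective
differential is a `C^∞` local diffeomorphism (Lee 2013, Thm. 4.5, through
`Literature.Geometry.Manifold.isLocalDiffeomorphAt_of_bijective_mfderiv` and the dimension
count `helper_diffeoOfProperInjective_bijective_mfderiv`). -/
theorem helper_diffeoOfProperInjective_isLocalDiffeomorph {S : HomotopySphere 4} {p : S.carrier}
    (Φ : ℂ × ℂ → punctured p) (hΦ : ContMDiff 𝓘(ℝ, ℂ × ℂ) (𝓡 4) ∞ Φ)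
    (hderiv : ∀ q : ℂ × ℂ, Function.Injective (mfderiv 𝓘(ℝ, ℂ × ℂ) (𝓡 4) Φ q)) :
    IsLocalDiffeomorph 𝓘(ℝ, ℂ × ℂ) (𝓡 4) ∞ Φ := fun q =>
  Literature.Geometry.Manifold.isLocalDiffeomorphAt_of_bijective_mfderiv isOpen_univ (mem_univ q)
    hΦ.contMDiffOn (helper_diffeoOfProperInjective_bijective_mfderiv Φ q (hderiv q))

/-- **Open-and-closed step.** A proper `C^∞` local diffeomorphism `Φ : ℂ × ℂ → Σ∖p` is
surjective: its range is open (local diffeomorphisms are open maps), closed (proper maps into the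
locally compact Hausdorff space `Σ∖p` are closed maps) and nonempty, and `Σ∖p` is connected
(`Literature.Geometry.Symplectic.pathConnectedSpace_punctured_of_homotopySphere`). -/
theorem helper_diffeoOfProperInjective_surjective {S : HomotopySphere 4} {p : S.carrier}
    (Φ : ℂ × ℂ → punctured p) (hΦ : ContMDiff 𝓘(ℝ, ℂ × ℂ) (𝓡 4) ∞ Φ)
    (hloc : IsLocalDiffeomorph 𝓘(ℝ, ℂ × ℂ) (𝓡 4) ∞ Φ)
    (hproper : ∀ K : Set (punctured p), IsCompact K → IsCompact (Φ ⁻¹' K)) :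
    Function.Surjective Φ := by
  haveI := pathConnectedSpace_punctured_of_homotopySphere S p
  haveI : LocallyCompactSpace (punctured p) :=
    ChartedSpace.locallyCompactSpace (EuclideanSpace ℝ (Fin 4)) (punctured p)
  have hprop : IsProperMap Φ :=
    isProperMap_iff_isCompact_preimage.2 ⟨hΦ.continuous, fun K hK => hproper K hK⟩
  have hclosed : IsClosed (range Φ) := hprop.isClosedMap.isClosed_range
  have hopen : IsOpen (range Φ) := hloc.isOpen_range
  have huniv : range Φ = univ := IsClopen.eq_univ ⟨hclosed, hopen⟩ (range_nonempty Φ)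
  exact range_eq_univ.1 huniv

/-- **A proper injective immersion `ℂ × ℂ → Σ∖p` is a diffeomorphism** (helper
`helper_diffeoOfProperInjective`, classical glue of line `Sketch`): a `C^∞`, injective, proper map
`Φ : ℂ × ℂ → Σ∖p` with everywhere injective differential is the underlying map of a
diffeomorphism `ℂ × ℂ ≃ₘ Σ∖p` (local diffeomorphism by the inverse function theorem and the
dimension count; surjective by the open-and-closed argument in the connected manifold `Σ∖p`;
then `IsLocalDiffeomorph.diffeomorphOfBijective`). -/
theorem helper_diffeoOfProperInjective :
    ∀ (S : HomotopySphere 4) (p : S.carrier) (Φ : ℂ × ℂ → punctured p),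
      ContMDiff 𝓘(ℝ, ℂ × ℂ) (𝓡 4) ∞ Φ → Function.Injective Φ →
      (∀ q : ℂ × ℂ, Function.Injective (mfderiv 𝓘(ℝ, ℂ × ℂ) (𝓡 4) Φ q)) →
      (∀ K : Set (punctured p), IsCompact K → IsCompact (Φ ⁻¹' K)) →
      ∃ F : (ℂ × ℂ) ≃ₘ⟮𝓘(ℝ, ℂ × ℂ), 𝓡 4⟯ (punctured p), ∀ q : ℂ × ℂ, F q = Φ q := by
  intro S p Φ hΦ hinj hderiv hproper
  have hloc : IsLocalDiffeomorph 𝓘(ℝ, ℂ × ℂ) (𝓡 4) ∞ Φ :=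
    helper_diffeoOfProperInjective_isLocalDiffeomorph Φ hΦ hderiv
  have hsurj : Function.Surjective Φ :=
    helper_diffeoOfProperInjective_surjective Φ hΦ hloc hproper
  exact ⟨hloc.diffeomorphOfBijective ⟨hinj, hsurj⟩, fun _ => rfl⟩

end Summit.SmoothPoincare4.SmoothPoincare4.Theorems.WitnessCharge.PencilIncompleteness

end
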